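import Literature.NumberTheory.EllipticCurves.Kobayashi2003.CyclotomicTowerSignedSelmer
import Mathlib.NumberTheory.Cyclotomic.Basic
import HarnessLib

/-!
# Kitajima–Otsuki 2018, Main Theorem 1.3 (= Thm. 4.8) for `F = ℚ`, BOTH signs, read on the
# `η`-components: `X^±(E/ℚ(μ_{p^∞}))^η` has no non-trivial finite `Λ`-submodule
# (`E/ℚ`, `p` odd, good reduction, `a_p = 0`; `η` a `{±1}`-valued character of `Gal(ℚ(μ_p)/ℚ)`)

Topic `Literature/NumberTheory/EllipticCurves`, cluster `KitajimaOtsuki2018` (namespace = path;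
sibling of `PlusSelmerNoFiniteSubmodule.lean`, which transcribes the same theorem over the base
`F_0 = ℚ(μ_p)` for the sign `+` only, on Def. 1.1's object WITHOUT the `m = −1` clause). ONE NAMED
FACT (`def … : Prop`, nothing asserted; net debt +1) on the Literature-homed object of Kobayashi's
Def. 2.1 over his own tower `K_n = ℚ(ζ_{p^{n+1}})` WITH the `m = −1` clause
(`Kobayashi2003/CyclotomicTowerSignedSelmer.lean`: `towerSignedLocalPointsOfEmb … (-1)`,
`towerSignedSelmerInftyEta`, `EtaSignedSelmerDualData`) — which is why the sign `−` is now
transcribable. Cell `bsd-cm`, seat `bsd-cm-k8i-ty` (D-0074 group (G), typer); bears on the K8 route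
`InertBadSignedBranches`, item stmt-BirchSwinnertonDyer-19226 `PrintReadingsInert` (conjunct 2,
reading (R2) `Additive.OddBranchStrictMinusNoFiniteSubmoduleAt`), and on cell `bsd-potss`
(`Additive/QuadraticBranchEvenReadingsOfEta.lean`, sign `+`). HONEST FRAMING (cell bsd-cm): the
programme assembles BSD for analytic-rank `≤ 1` curves strictly from published theorems and TYPES
the remainder; BSD is not proved by any of this. The text of the fact is, binder for binder and for
the sign `−`, the hypothesis text `HKO` of cc-typer-6's plan of record (`run/shared/lean/b2b/
bsd-rank1-residual/class-closure/typer-6/P5-FIRST-SAY-typer6.md` (Q1).4) = the hypothesis `hKO` of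
the kernel dictionary theorem `Additive.SignedTwist.oddBranchStrictMinusNoFiniteSubmoduleAt_of_kitajimaOtsuki13MinusEta`
(x1b P5-5b), so the fact instantiates it with no glue (Theorems-side file of this seat).

## Source, read at the page (held copy `paper:arxiv-1607.03612` = arXiv:1607.03612v1, the
## preprint of Tokyo J. Math. 41 (2018) 273–303, doi:10.3836/tjm/1502179270; verbatim quotations as
## already page-checked in the sibling file `PlusSelmerNoFiniteSubmodule.lean`, pp. 3, 4, 6)

Introduction (arXiv p. 3), with `Λ = ℤ_p[[Gal(F_∞/F_0)]]`: "**Main Theorem 1.3** (Theorem 4.8). Let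
`F` be a finite extension of `ℚ`, `F_0 = F(μ_p)`, `F_∞/F_0` the cyclotomic `ℤ_p`-extension, and `E`
an elliptic curve defined over a subfield `F'` of `F`. … Assume the following conditions: (i) `E`
has good reduction at any prime of `F'` lying above `p`, (ii) `S_p^{ss}` is nonempty, (iii) any
prime `w ∈ S_p^{ss}` is unramified in `F`, (iv) `F'_w = ℚ_p` for any prime `w ∈ S_p^{ss}` …, (v)
`a_w = 1 + p − #Ẽ_w(𝔽_p) = 0` for any prime `w ∈ S_p^{ss}` …, and (vi) both
`Sel^±(F_∞, E[p^∞])^∨` are `Λ`-torsion. Then both `Sel^±(F_∞, E[p^∞])^∨` have no nontrivial finite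
`Λ`-submodule." §2 (p. 6): "**Definition 2.1.** (1) … `E⁺(F_{n,v}) = {P ∈ E(F_{n,v}) | Tr_{n/m+1} P
∈ E(F_{m,v}) for all even m, −1 ≤ m ≤ n−1}`, `E⁻(F_{n,v}) = {P ∈ E(F_{n,v}) | Tr_{n/m+1} P ∈
E(F_{m,v}) for all odd m, −1 ≤ m ≤ n−1}` … (2) `Sel^±(F_n, E[p^∞]) := Ker( Sel(F_n, E[p^∞]) →
⊕_{v ∈ S^{ss}_{p,F}} H¹(F_{n,v}, E[p^∞]) / E^±(F_{n,v}) ⊗ ℚ_p/ℤ_p )`, `Sel^±(F_∞, E[p^∞]) :=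
lim→_n Sel^±(F_n, E[p^∞])` … `Sel^±(F_∞, E[p^∞])^∨` is known to be `Λ(𝒢_∞)`-torsion in the case
`F = ℚ` (cf. [Kob03] Theorem 2.2)." Remark 1.4 (5) (p. 4): "… Suppose that `E` is defined over `ℚ`
and has supersingular reduction at `p` with `a_p = 0`. In this case, one can actually show that
`Sel^±(F_∞, E[p^∞])^∨` is `Λ`-torsion. Our main theorem implies that `Sel^±(F_∞, E[p^∞])^∨` has no
nontrivial finite `Λ`-submodule for any finite abelian field `F_0`."

## Transcription (the case `F = F' = ℚ`: `F_0 = ℚ(μ_p) = K₀`, `F_n = ℚ(μ_{p^{n+1}}) = K_n`,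
## `F_∞ = ℚ(μ_{p^∞}) = K_∞`; BOTH signs; flags `KO18-F=Q-Rem14(5)`, `KO18-eta-summand`)

* For `F = F' = ℚ` conditions (i)–(v) read: `E = V/ℚ` has good reduction at the odd `p` and
  `a_p = 0` ((iii)/(iv) empty); (vi) is discharged in print for `F = ℚ` (§2 p. 6, Remark 1.4 (5)) but
  is nevertheless KEPT as displayed hypotheses (finite generation + torsion of the datum's module; they
  are Kobayashi's Thm. 2.2 = the sibling fact `Kobayashi2003.thm22_etaSignedSelmerDual_finite_torsion`).
* Def. 2.1's `E^±(F_{n,v})` for `F_{−1} = ℚ` ("`−1 ≤ m ≤ n−1`") IS Kobayashi's `E^±(K_{n,v})` (§2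
  p. 4: even `m`, `0 ≤ m < n` / odd `m`, `−1 ≤ m < n`) = the object file's
  `towerSignedLocalPointsOfEmb (towerSubgroup κ K₀) (closureEmb E) V ε n` with its `m = −1` clause for
  `ε = −1`; `Sel^±(F_∞, E[p^∞]) = towerSignedSelmerInfty V κ K₀ ℚ_[p] ε` (ONE prime of `K_n` above
  `p`, so "⊕ over `v ∈ S^{ss}`" is the single condition imposed at the model `ℚ_[p]` and all its
  conjugates).
* `η`-COMPONENT (flag `KO18-eta-summand`): the print is for `X^±(F_∞) = Sel^±(F_∞, E[p^∞])^∨` WHOLE;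
  for a `{±1}`-valued character `η` of `Δ = Gal(K₀/ℚ)` (`#Δ = p − 1` prime to `p`) the dual of the
  `η`-eigen-subgroup `Sel^±(F_∞)^η` is the direct summand `ε_η X^±(F_∞)` of `X^±(F_∞)`, and a direct
  summand of a `Λ`-module without non-trivial finite submodules has none — an elementary step which
  the tree cannot run for want of a whole-`X^±` dual datum over `K_∞` with its `Δ`-action; SAID, not
  hidden. The fact is stated for every such `η` (so `η = 1` gives the `Δ`-invariant part) and both
  signs, on any datum `D : EtaSignedSelmerDualData V κ K₀ ℚ_[p] η γ ε` with `γ ∈ Gal(ℚ̄/K₀)` a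
  topological generator of the cyclotomic `κ` (`Λ = ℤ_p⟦T⟧ = ℤ_p[[Gal(F_∞/F_0)]]`, `T = γ − 1`).
* "has no nontrivial finite `Λ`-submodule" = `∀ M : Submodule Λ D.X, Finite M → M = ⊥`.

What is NOT here: `F ≠ ℚ`; Main Theorem 1.7 / Thm. 1.8; any proof. TODO(general form): `F` any
number field with `p` unramified, `E` over `F' ⊆ F` with `F'_w = ℚ_p`, as printed.

References: [KitajimaOtsuki2018] Main Thm. 1.3 (= Thm. 4.8), Def. 2.1, §2 p. 6, Remark 1.4 (5)
(arXiv:1607.03612 pp. 3, 4, 6); [Kobayashi2003] §2 p. 4, Def. 2.1 and Thm. 2.2 (p. 5), §4 p. 8.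
-/

noncomputable section

open scoped Classical

open WeierstrassCurve Field Literature.NumberTheory.EllipticCurves
  Literature.NumberTheory.GaloisRepresentations Literature.NumberTheory.EllipticCurves.Kobayashi2003
  ZpExtension

namespace Literature.NumberTheory.EllipticCurves.KitajimaOtsuki2018

/-- **Kitajima–Otsuki 2018, Main Theorem 1.3 (= Thm. 4.8), case `F = F' = ℚ`, BOTH signs, on the
`η`-components: `X^ε(E/ℚ(μ_{p^∞}))^η` has no non-trivial finite `Λ`-submodule.** As printed: "Let
`F` be a finite extension of `ℚ`, `F_0 = F(μ_p)`, `F_∞/F_0` the cyclotomic `ℤ_p`-extension, and `E`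
an elliptic curve defined over a subfield `F'` of `F`. … Assume (i) `E` has good reduction at any
prime of `F'` lying above `p`, (ii) `S_p^{ss}` is nonempty, (iii) any prime `w ∈ S_p^{ss}` is
unramified in `F`, (iv) `F'_w = ℚ_p` …, (v) `a_w = 0` …, and (vi) both `Sel^±(F_∞, E[p^∞])^∨` are
`Λ`-torsion. Then both `Sel^±(F_∞, E[p^∞])^∨` have no nontrivial finite `Λ`-submodule" (`p` odd;
Def. 2.1 with "`−1 ≤ m ≤ n−1`", i.e. Kobayashi's `E^±(K_{n,v})` WITH the `m = −1` clause for the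
sign `−`; (vi) discharged in print for `F = ℚ` by §2 p. 6 / Remark 1.4 (5), kept displayed). Here:
`K₀ = ℚ(μ_p)` (`IsCyclotomicExtension {p} ℚ K₀`), `η : Γ_ℚ →* ℤˣ` trivial on `galRange K₀` (a
`{±1}`-valued character of `Δ`; flag `KO18-eta-summand`: an `η`-part is a direct summand of the
printed whole `X^±(F_∞)`), `V/ℚ` globally minimal with good reduction at the odd `p` and `a_p = 0`,
`κ` the cyclotomic `ℤ_p`-extension of `ℚ` with topological generator `γ ∈ Gal(ℚ̄/K₀)`, any sign
`ε`, and ANY Pontryagin-dual datum `D` of `Sel^ε(V/K_∞)^η` at the model `ℚ_[p]`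
(`Kobayashi2003.EtaSignedSelmerDualData`) whose module is finitely generated and `Λ`-torsion: every
finite `Λ`-submodule of `D.X` is trivial. At `ε = −1` the text is cc-typer-6's `HKO` (the
hypothesis `hKO` of x1b's P5-5b dictionary theorem); at `ε = 1` it is cell bsd-potss's `hKO`.
Named fact; nothing asserted; no `_holds`.
[cite: KitajimaOtsuki2018, Main Thm. 1.3 (= Thm. 4.8) with Def. 2.1, §2 p. 6 and Remark 1.4 (5) (arXiv:1607.03612 pp. 3, 4, 6)]
[cite: Kobayashi2003, §2 p. 4 and Def. 2.1 (p. 5) (the object), Thm. 2.2 (p. 5) (hypothesis (vi) for F = ℚ), §4 p. 8 (η-components)] -/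
def mainThm13_etaSignedSelmerDual_noFiniteSubmodule : Prop :=
  ∀ (p : ℕ) [Fact p.Prime] (K₀ : Type) [Field K₀] [NumberField K₀] [IsCyclotomicExtension {p} ℚ K₀]
    [(galRange (K := ℚ) K₀).Normal] (η : absoluteGaloisGroup ℚ →* ℤˣ),
    (∀ σ ∈ galRange (K := ℚ) K₀, η σ = 1) →
  ∀ (V : WeierstrassCurve ℚ) [V.IsElliptic] [V.IsGloballyMinimal],
    p ≠ 2 → V.HasGoodReductionAtPrime p → V.frobeniusTrace p = 0 →
  ∀ (κ : ZpExtension ℚ p) (γ : absoluteGaloisGroup ℚ),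
    κ.IsCyclotomic → κ.IsTopGenerator γ → γ ∈ galRange (K := ℚ) K₀ →
  ∀ (ε : ℤˣ) (D : EtaSignedSelmerDualData V κ K₀ ℚ_[p] η γ ε),
    Module.Finite (IwasawaAlgebra p) D.X → Module.IsTorsion (IwasawaAlgebra p) D.X →
    ∀ M : Submodule (IwasawaAlgebra p) D.X, Finite M → M = ⊥

end Literature.NumberTheory.EllipticCurves.KitajimaOtsuki2018

end
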